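import Summits.ResolutionOfSingularities.ResolutionOfSingularities.Theorems.FrobeniusLadderFInjectiveMacaulayficationLoopGermLCharts
import HarnessLib

/-!
# (O-3)(iii) THE SECOND LOOP GERM `M = e² + a²ce + ac² + a²cd² + ab³c²` AND ITS SINGULAR-PLANE BLOW-UP `Bl_{(a,c,e)}`: the loop in the kernel
# (crux `FInjectiveMacaulayfication` stmt-ResolutionOfSingularities-15315, chain w45a; res-L1-w45a-plan-1 g19 RULING R19.18 (iii); seat res-L1-w45a-stub-3 g10)

[OURS · L1 W4.5a] Support file (`--supports stmt-ResolutionOfSingularities-15315 --as helper`); unconditional; def-free; replaces the role of NO printed item;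
NOT a statement of the manuscript; AI-written (AI review is weaker than expert review). Companion of `…LoopGermLCharts` (✓ p641754).

SETTING. `M = X4² + X0²X2X4 + X0X2² + X0²X2X3² + X0X1³X2²` (`a,…,e = X0,…,X4`) is res-L1-w45a-idea-1's `K₂` (FB5-r7 §1.2), the partner of `L = K₁` in the rad-τ
loop `L ⇄ M` of d4lx6q7 (R19.16): `rad τ(M) = (a,c,e)` (a plane) and idea-1's exhaustive policy search found NO one-step cure of `M`, the minimal policy being
«`V(a,c,e)`, then `V(c,d,e)` on chart `a`». This file is the chart-level kernel content of that statement's first half: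
* §1 ★ `prime_M` (any field; Eisenstein-type at `(1,0,0,1)`), `M_mem_sq_ace : M ∈ (a,c,e)²` (so `V(a,c,e) ⊆ Sing`);
* §2 the strict transforms under the blow-up of the PLANE `V(a,c,e)` (`θ_a : c ↦ ca, e ↦ ea`; `θ_c : a ↦ ac, e ↦ ec`; `θ_e : a ↦ ae, c ↦ ce`; `b, d` fixed):
  ★★ `theta_a : M∘θ_a = a² · L` — THE `a`-CHART OF `Bl_{(a,c,e)} U_M` IS `U_L` ON THE NOSE (the strict transform is LITERALLY the polynomial `L` of
  `…LoopGermLCharts`, in the chart coordinates `(a, b, c′, d, e′)`): the loop `M → L` in the kernel; `theta_c : M∘θ_c = c²·M_c`, `M_c = e′² + a′²c²e′ + a′c + a′²cd² + a′b³c`;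
  `theta_e : M∘θ_e = e²·M_e`, `M_e = 1 + a′²ce² + a′c′²e + a′²c′d²e + a′b³c′²e`; `prime_M_c`;
* §3 ★★ the CURE of the two other charts at chart level (`char k = 2`): `clause_chart_c` (thin cell `a′c`, coefficient `1`), `clause_chart_e` (thin cell `1`):
  `k[X]/(M_c)`, `k[X]/(M_e)` satisfy the CM + Frobenius-closed clause at EVERY maximal ideal (`E4GermPointBlowupFull.clause_of_thinCell`).
So after ONE blow-up of the singular plane `V(a,c,e)` the only non-FULL points of `Bl U_M` sit in the `a`-chart `= U_L`, whose cure is `…LoopGermLCureFin5.loopGerm_cure_fin5`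
(one more plane, `V(c′,d,e′)`) — idea-1's 2-round policy. The scheme-level identification of the `a`-chart is the sequel file.
[folklore mathematics, OURS as a certificate; cite: Fedder1983, Prop. 1.7 and Thm. 1.12; Kollar2007, §2.5 (strict transforms); StacksProject, Tag 0804]
-/

-- single-problem summit: the doubled namespace component is forced
set_option linter.dupNamespace false

noncomputable section

open AlgebraicGeometry CategoryTheory Literature.AlgebraicGeometry.Resolution TopologicalSpace IsLocalRing MvPolynomial

namespace Summit.ResolutionOfSingularities.ResolutionOfSingularities.Theorems.FInjectiveMacaulayfication.LoopGermMCharts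

open Summit.ResolutionOfSingularities.ResolutionOfSingularities.Theorems.FInjectiveMacaulayfication
open SliceableCentre

variable (k : Type) [Field k]

/-! ## §1 The germ `M`: primality, `M ∈ (a,c,e)²` -/

/-- ★ **`M` is PRIME** over any field: `T² + C(a²c)·T + C(ac² + a²cd² + ab³c²)`, at `(a,b,c,d) = (1,0,0,1)`: `a²c = 0`, the constant coefficient vanishes, and
`∂_c(ac² + a²cd² + ab³c²) = 2ac + a²d² + 2ab³c = 1`. [folklore; `LoopGermLCharts.prime_of_quadric`] -/
theorem prime_M (f : MvPolynomial (Fin 5) k) (hf : f = X 4 ^ 2 + X 0 ^ 2 * X 2 * X 4 + X 0 * X 2 ^ 2 + X 0 ^ 2 * X 2 * X 3 ^ 2 + X 0 * X 1 ^ 3 * X 2 ^ 2) : Prime f := by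
  refine LoopGermLCharts.prime_of_quadric k f (X 0 ^ 2 * X 2) (X 0 * X 2 ^ 2 + X 0 ^ 2 * X 2 * X 3 ^ 2 + X 0 * X 1 ^ 3 * X 2 ^ 2) ?_ ![1, 0, 0, 1] ?_ ?_ 2 ?_
  · rw [hf]; simp only [map_add, map_mul, map_pow, rename_X, Fin.castSucc_zero]; simp; ring
  · simp
  · simp
  · have e1 : pderiv 2 (X 0 * X 2 ^ 2 + X 0 ^ 2 * X 2 * X 3 ^ 2 + X 0 * X 1 ^ 3 * X 2 ^ 2 : MvPolynomial (Fin 4) k) =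
        2 * (X 0 * X 2) + X 0 ^ 2 * X 3 ^ 2 + 2 * (X 0 * X 1 ^ 3 * X 2) := by
      simp only [map_add, Derivation.leibniz, Derivation.leibniz_pow, pderiv_X_self, smul_eq_mul, pderiv_X_of_ne (show (0 : Fin 4) ≠ 2 by decide),
        pderiv_X_of_ne (show (1 : Fin 4) ≠ 2 by decide), pderiv_X_of_ne (show (3 : Fin 4) ≠ 2 by decide)]
      push_cast; ring
    rw [e1]; simp

/-- `M ∈ (a, c, e)²` (so the plane `V(a,c,e)` lies in the non-regular locus). [certificate] -/
theorem M_mem_sq_ace (f : MvPolynomial (Fin 5) k) (hf : f = X 4 ^ 2 + X 0 ^ 2 * X 2 * X 4 + X 0 * X 2 ^ 2 + X 0 ^ 2 * X 2 * X 3 ^ 2 + X 0 * X 1 ^ 3 * X 2 ^ 2) :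
    f ∈ (Ideal.span ({X 0, X 2, X 4} : Set (MvPolynomial (Fin 5) k))) ^ 2 := by
  have ha : (X 0 : MvPolynomial (Fin 5) k) ∈ Ideal.span ({X 0, X 2, X 4} : Set (MvPolynomial (Fin 5) k)) := Ideal.subset_span (by simp)
  have hc : (X 2 : MvPolynomial (Fin 5) k) ∈ Ideal.span ({X 0, X 2, X 4} : Set (MvPolynomial (Fin 5) k)) := Ideal.subset_span (by simp)
  have he : (X 4 : MvPolynomial (Fin 5) k) ∈ Ideal.span ({X 0, X 2, X 4} : Set (MvPolynomial (Fin 5) k)) := Ideal.subset_span (by simp)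
  have h2 : ∀ (p q : MvPolynomial (Fin 5) k), p ∈ Ideal.span ({X 0, X 2, X 4} : Set (MvPolynomial (Fin 5) k)) →
      q ∈ Ideal.span ({X 0, X 2, X 4} : Set (MvPolynomial (Fin 5) k)) → p * q ∈ (Ideal.span ({X 0, X 2, X 4} : Set (MvPolynomial (Fin 5) k))) ^ 2 :=
    fun p q hp hq => by rw [pow_two]; exact Ideal.mul_mem_mul hp hq
  rw [hf, show (X 4 ^ 2 + X 0 ^ 2 * X 2 * X 4 + X 0 * X 2 ^ 2 + X 0 ^ 2 * X 2 * X 3 ^ 2 + X 0 * X 1 ^ 3 * X 2 ^ 2 : MvPolynomial (Fin 5) k) = X 4 * X 4 + X 0 * X 4 * (X 0 * X 2) + X 2 * (X 0 * X 2) + X 2 * X 3 ^ 2 * (X 0 * X 0) + X 1 ^ 3 * X 2 * (X 0 * X 2) by ring]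
  refine Ideal.add_mem _ (Ideal.add_mem _ (Ideal.add_mem _ (Ideal.add_mem _ (h2 _ _ he he) ?_) ?_) ?_) ?_
  · exact Ideal.mul_mem_left _ _ (h2 _ _ ha hc)
  · exact Ideal.mul_mem_left _ _ (h2 _ _ ha hc)
  · exact Ideal.mul_mem_left _ _ (h2 _ _ ha ha)
  · exact Ideal.mul_mem_left _ _ (h2 _ _ ha hc)

/-! ## §2 The strict transforms under the blow-up of the plane `V(a,c,e)` -/

/-- ★★ **Chart `D(a)`: THE LOOP `M → L` IN THE KERNEL.** `θ_a : c ↦ ca, e ↦ ea` gives `M∘θ_a = a²·L` with `L = e′² + a²c′e′ + ac′² + ac′d² + ab³c′²` LITERALLY the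
polynomial of `…LoopGermLCharts` (chart coordinates `(a,b,c′,d,e′) = (X0,…,X4)`). [folklore; idea-1 FB5-r7 §1.2] -/
theorem theta_a (f : MvPolynomial (Fin 5) k) (hf : f = X 4 ^ 2 + X 0 ^ 2 * X 2 * X 4 + X 0 * X 2 ^ 2 + X 0 ^ 2 * X 2 * X 3 ^ 2 + X 0 * X 1 ^ 3 * X 2 ^ 2) :
    aeval ![(X 0 : MvPolynomial (Fin 5) k), X 1, X 2 * X 0, X 3, X 4 * X 0] f = X 0 ^ 2 * (X 4 ^ 2 + X 0 ^ 2 * X 2 * X 4 + X 0 * X 2 ^ 2 + X 0 * X 2 * X 3 ^ 2 + X 0 * X 1 ^ 3 * X 2 ^ 2) := by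
  subst hf; simp; ring

/-- ★ **Chart `D(c)`**: `θ_c : a ↦ ac, e ↦ ec` gives `M∘θ_c = c²·M_c`, `M_c = e′² + a′²c²e′ + a′c + a′²cd² + a′b³c`. [folklore] -/
theorem theta_c (f : MvPolynomial (Fin 5) k) (hf : f = X 4 ^ 2 + X 0 ^ 2 * X 2 * X 4 + X 0 * X 2 ^ 2 + X 0 ^ 2 * X 2 * X 3 ^ 2 + X 0 * X 1 ^ 3 * X 2 ^ 2) :
    aeval ![(X 0 * X 2 : MvPolynomial (Fin 5) k), X 1, X 2, X 3, X 4 * X 2] f = X 2 ^ 2 * (X 4 ^ 2 + X 0 ^ 2 * X 2 ^ 2 * X 4 + X 0 * X 2 + X 0 ^ 2 * X 2 * X 3 ^ 2 + X 0 * X 1 ^ 3 * X 2) := by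
  subst hf; simp; ring

/-- ★ **Chart `D(e)`**: `θ_e : a ↦ ae, c ↦ ce` gives `M∘θ_e = e²·M_e`, `M_e = 1 + a′²c′e² + a′c′²e + a′²c′d²e + a′b³c′²e`. [folklore] -/
theorem theta_e (f : MvPolynomial (Fin 5) k) (hf : f = X 4 ^ 2 + X 0 ^ 2 * X 2 * X 4 + X 0 * X 2 ^ 2 + X 0 ^ 2 * X 2 * X 3 ^ 2 + X 0 * X 1 ^ 3 * X 2 ^ 2) :
    aeval ![(X 0 * X 4 : MvPolynomial (Fin 5) k), X 1, X 2 * X 4, X 3, X 4] f = X 4 ^ 2 * (1 + X 0 ^ 2 * X 2 * X 4 ^ 2 + X 0 * X 2 ^ 2 * X 4 + X 0 ^ 2 * X 2 * X 3 ^ 2 * X 4 + X 0 * X 1 ^ 3 * X 2 ^ 2 * X 4) := by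
  subst hf; simp; ring

/-- `M_c` is prime (any field): `T² + C(a′²c²)T + C(a′c + a′²cd² + a′b³c)`, at `(1,0,0,0)` the constant coefficient vanishes with `∂_c = a′ + a′²d² + a′b³ = 1`.
[folklore] -/
theorem prime_M_c (g : MvPolynomial (Fin 5) k) (hg : g = X 4 ^ 2 + X 0 ^ 2 * X 2 ^ 2 * X 4 + X 0 * X 2 + X 0 ^ 2 * X 2 * X 3 ^ 2 + X 0 * X 1 ^ 3 * X 2) : Prime g := by
  refine LoopGermLCharts.prime_of_quadric k g (X 0 ^ 2 * X 2 ^ 2) (X 0 * X 2 + X 0 ^ 2 * X 2 * X 3 ^ 2 + X 0 * X 1 ^ 3 * X 2) ?_ ![1, 0, 0, 0] ?_ ?_ 2 ?_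
  · rw [hg]; simp only [map_add, map_mul, map_pow, rename_X, Fin.castSucc_zero]; simp; ring
  · simp
  · simp
  · have e1 : pderiv 2 (X 0 * X 2 + X 0 ^ 2 * X 2 * X 3 ^ 2 + X 0 * X 1 ^ 3 * X 2 : MvPolynomial (Fin 4) k) =
        X 0 + X 0 ^ 2 * X 3 ^ 2 + X 0 * X 1 ^ 3 := by
      simp only [map_add, Derivation.leibniz, Derivation.leibniz_pow, pderiv_X_self, smul_eq_mul, pderiv_X_of_ne (show (0 : Fin 4) ≠ 2 by decide),
        pderiv_X_of_ne (show (1 : Fin 4) ≠ 2 by decide), pderiv_X_of_ne (show (3 : Fin 4) ≠ 2 by decide)]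
      push_cast; ring
    rw [e1]; simp

/-! ## §3 ★★ The cure of the charts `D(c)`, `D(e)` at chart level: thin Fedder cells (def-free: data inlined) -/

/-- ★★ **CURE of chart `D(c)` at chart level**: `k[X]/(M_c)` satisfies the CM + Frobenius-closed clause at EVERY maximal ideal (`char k = 2`) — one thin
Fedder cell (the square-free class `a′c` with unit coefficient; term list and cell inlined, certificate by `decide +kernel`). [cite: Fedder1983, Thm. 1.12] -/
theorem clause_chart_c [CharP k 2] (g : MvPolynomial (Fin 5) k) (hg : g = X 4 ^ 2 + X 0 ^ 2 * X 2 ^ 2 * X 4 + X 0 * X 2 + X 0 ^ 2 * X 2 * X 3 ^ 2 + X 0 * X 1 ^ 3 * X 2)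
    (Q : Ideal (MvPolynomial (Fin 5) k ⧸ Ideal.span {g})) [Q.IsMaximal] :
    ∀ d : ℕ, ringKrullDim (Localization.AtPrime Q) = d → ∀ s : Fin d → Localization.AtPrime Q,
      (Ideal.span (Set.range s)).radical.IsMaximal →
        RingTheory.Sequence.IsWeaklyRegular (Localization.AtPrime Q) (List.ofFn s) ∧
        ∀ y : Localization.AtPrime Q, (∃ e : ℕ, y ^ 2 ^ e ∈ Ideal.span
          ((fun z : Localization.AtPrime Q => z ^ 2 ^ e) '' (Ideal.span (Set.range s) : Set (Localization.AtPrime Q)))) → y ∈ Ideal.span (Set.range s) :=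
  E4GermPointBlowupFull.clause_of_thinCell k
    [((1 : ℤ), ![0, 0, 0, 0, 2]), ((1 : ℤ), ![2, 0, 2, 0, 1]), ((1 : ℤ), ![1, 0, 1, 0, 0]), ((1 : ℤ), ![2, 0, 1, 2, 0]), ((1 : ℤ), ![1, 3, 1, 0, 0])]
    [((∅ : Finset (Fin 5)), [(![1, 0, 1, 0, 0], [((1 : ℤ), ![0, 0, 0, 0, 0])])], (fun _ => []), [])]
    (by decide +kernel) (by simp) (by decide +kernel) g
    (hg.trans (by simp only [KLocCellKit.evalL, List.map_cons, List.map_nil, List.sum_cons, List.sum_nil, Int.cast_one, PConeFedderData.monomial_five]; ring)) Q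

/-- ★★ **CURE of chart `D(e)` at chart level**: `k[X]/(M_e)` satisfies the CM + Frobenius-closed clause at EVERY maximal ideal (`char k = 2`) — one thin
Fedder cell (the square-free class `1` (the constant) with unit coefficient; term list and cell inlined, certificate by `decide +kernel`). [cite: Fedder1983, Thm. 1.12] -/
theorem clause_chart_e [CharP k 2] (g : MvPolynomial (Fin 5) k) (hg : g = 1 + X 0 ^ 2 * X 2 * X 4 ^ 2 + X 0 * X 2 ^ 2 * X 4 + X 0 ^ 2 * X 2 * X 3 ^ 2 * X 4 + X 0 * X 1 ^ 3 * X 2 ^ 2 * X 4)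
    (Q : Ideal (MvPolynomial (Fin 5) k ⧸ Ideal.span {g})) [Q.IsMaximal] :
    ∀ d : ℕ, ringKrullDim (Localization.AtPrime Q) = d → ∀ s : Fin d → Localization.AtPrime Q,
      (Ideal.span (Set.range s)).radical.IsMaximal →
        RingTheory.Sequence.IsWeaklyRegular (Localization.AtPrime Q) (List.ofFn s) ∧
        ∀ y : Localization.AtPrime Q, (∃ e : ℕ, y ^ 2 ^ e ∈ Ideal.span
          ((fun z : Localization.AtPrime Q => z ^ 2 ^ e) '' (Ideal.span (Set.range s) : Set (Localization.AtPrime Q)))) → y ∈ Ideal.span (Set.range s) :=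
  E4GermPointBlowupFull.clause_of_thinCell k
    [((1 : ℤ), ![0, 0, 0, 0, 0]), ((1 : ℤ), ![2, 0, 1, 0, 2]), ((1 : ℤ), ![1, 0, 2, 0, 1]), ((1 : ℤ), ![2, 0, 1, 2, 1]), ((1 : ℤ), ![1, 3, 2, 0, 1])]
    [((∅ : Finset (Fin 5)), [(![0, 0, 0, 0, 0], [((1 : ℤ), ![0, 0, 0, 0, 0])])], (fun _ => []), [])]
    (by decide +kernel) (by simp) (by decide +kernel) g
    (hg.trans (by simp only [KLocCellKit.evalL, List.map_cons, List.map_nil, List.sum_cons, List.sum_nil, Int.cast_one, PConeFedderData.monomial_five]; ring)) Q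

end Summit.ResolutionOfSingularities.ResolutionOfSingularities.Theorems.FInjectiveMacaulayfication.LoopGermMCharts

end
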